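import Literature.NumberTheory.EllipticCurves.BSDSelmerPConverse
import Literature.Barriers.BirchSwinnertonDyer.PAdicFunctionalEquationParityProofs
import Literature.NumberTheory.QuadraticFields.KroneckerSplitting
import Literature.NumberTheory.QuadraticFields.JacobiCharacter
import Literature.NumberTheory.QuadraticFields.FundamentalDiscriminant
import Literature.NumberTheory.EllipticCurves.ModularityVersionApProofs
import Summits.BirchSwinnertonDyer.BirchSwinnertonDyer.Theorems.PrintCf2DisegniPairTwoFrameFields
import HarnessLib

/-!
# Road (C) `disegni-pair-two` on crux stmt-BirchSwinnertonDyer-20368 — FRAME, the Friedberg–Hoffstein field `K`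

LEAD `bsd-line-cf2-p1` g21, for the registered stub `stub_frame_two` of `Lines/disegni_pair_two.lean` (v3). From the
named fact `friedbergHoffstein_exists_heegnerField_split_twist_ne_zero` (S0′) and modularity (S0′), for a rank-one member `W`
(`w(W) = −1` by parity): an imaginary quadratic `K`, Galois over `ℚ`, with `2` split (`d_K ≡ 1 (mod 8)`, two primes
`𝔭 ≠ 𝔭′` above `2`), every prime of `N(W)` split — so `W` has GOOD reduction at the (ramified) primes of `d_K` — and
`L(W^{(d_K)}, 1) ≠ 0` (`exists_heegnerField`); and its Kronecker character `κ = (·/|d_K|)` as a Dirichlet character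
mod `|d_K|` with `κ(ℓ) = (d_K/ℓ)` at odd primes and `κ(2) = 1` (`exists_kroneckerChar`). THEOREMS ONLY; no `sorry`;
no new definitions. BSD is not proved by any of this; 20368 is not closed here.
-/

set_option linter.dupNamespace false

noncomputable section

open scoped Classical NumberField NumberTheorySymbols

open NumberField IsDedekindDomain WeierstrassCurve Literature.NumberTheory.EllipticCurves
  Literature.NumberTheory.EllipticCurves.ModularForms Literature.NumberTheory.QuadraticFields

namespace Summit.BirchSwinnertonDyer.BirchSwinnertonDyer.Theorems.PrintCf2.DisegniPairTwo

/-! ### §1 The Friedberg–Hoffstein field of a rank-one member -/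

/-- **THE FRIEDBERG–HOFFSTEIN FIELD `K` of a rank-one member `W`.** From the named facts (modularity, Friedberg–Hoffstein):
an imaginary quadratic `K`, Galois over `ℚ`, `2` split (two primes `𝔭 ≠ 𝔭′` above `2`, `d_K ≡ 1 (mod 8)`), `d_K` squarefree,
`W` with GOOD reduction at every prime dividing `d_K` (those primes ramify, the primes of `N(W)` split), and `L(W^{(d_K)}, 1) ≠ 0`.
[cite: FriedbergHoffstein1995, main theorem] [cite: GrossZagier1986, I.§3 (Heegner hypothesis)] -/
theorem exists_heegnerField (hnew : exists_isNewformOf) (hFH : friedbergHoffstein_exists_heegnerField_split_twist_ne_zero)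
    (W : WeierstrassCurve ℚ) [W.IsElliptic] (hr : W.analyticRank = 1) :
    ∃ (K : Type) (_ : Field K) (_ : NumberField K) (_ : IsGalois ℚ K),
      IsImaginaryQuadratic K ∧ Module.finrank ℚ K = 2 ∧
      ((Ideal.span {(2 : ℤ)}).primesOver (𝓞 K)).ncard = 2 ∧
      (∃ 𝔭 𝔭' : HeightOneSpectrum (𝓞 K), ((2 : ℕ) : 𝓞 K) ∈ 𝔭.asIdeal ∧ ((2 : ℕ) : 𝓞 K) ∈ 𝔭'.asIdeal ∧ 𝔭 ≠ 𝔭') ∧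
      NumberField.discr K % 8 = 1 ∧ Squarefree (NumberField.discr K) ∧ NumberField.discr K < 0 ∧
      (∀ v : HeightOneSpectrum (𝓞 ℚ), ((Rat.HeightOneSpectrum.primesEquiv v : ℕ) : ℤ) ∣ NumberField.discr K →
        W.HasGoodReductionAt v) ∧
      (W.quadraticTwist (NumberField.discr K : ℚ)).entireLFunction 1 ≠ 0 := by
  -- parity: `r_an(W) = 1 ⟹ w(W) = −1` (the tree's `rootNumber_eq_neg_one_of_analyticRank_eq_one`, inlined)
  have hw : W.rootNumber = -1 := by
    haveI : NeZero (W.conductorNorm ℤ) := ⟨(conductorNorm_pos_holds W).ne'⟩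
    obtain ⟨f, hf⟩ := hnew W
    rcases W.rootNumber_eq_one_or with h | h
    · exfalso
      have hev : Even W.analyticRank :=
        (Literature.Barriers.BirchSwinnertonDyer.even_analyticRank_iff_of_isNewformOf_conductorLevel hf).mpr h
      rw [hr] at hev
      exact Nat.not_even_one hev
    · exact h
  obtain ⟨K, _, _, hK, -, hHeeg, h2, hL⟩ := hFH W hw 2 Nat.prime_two 0
  haveI : IsGalois ℚ K := isGalois_rat_of_isImaginaryQuadratic hK
  have hfin : Module.finrank ℚ K = 2 := hK.1
  have hsplit : ((Ideal.span {(2 : ℤ)}).primesOver (𝓞 K)).ncard = 2 := h2 2 Nat.prime_two (dvd_refl 2)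
  have h8 : NumberField.discr K % 8 = 1 := discr_mod_eight_eq_one_of_split hfin hsplit
  have hsq : Squarefree (NumberField.discr K) := by
    rcases Quadratic.isFundamentalDiscriminant_discr (K := K) hfin with ⟨-, hsq, -⟩ | ⟨h4, -, -⟩
    · exact hsq
    · exfalso; omega
  refine ⟨K, inferInstance, inferInstance, inferInstance, hK, hfin, hsplit, exists_two_primes_above Nat.prime_two hsplit, h8,
    hsq, hK.discr_neg, fun v hv => ?_, hL⟩
  -- primes of `d_K` ramify; primes of `N(W)` split ⟹ `W` is good at the primes of `d_K`
  by_contra hbad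
  set ℓ : ℕ := (Rat.HeightOneSpectrum.primesEquiv v : ℕ) with hℓ
  have hℓp : ℓ.Prime := (Rat.HeightOneSpectrum.primesEquiv v).2
  have hℓN : ℓ ∣ W.conductorNorm ℤ := (W.dvd_conductorNorm_iff v).mpr hbad
  have hsp : ((Ideal.span {(ℓ : ℤ)}).primesOver (𝓞 K)).ncard = 2 := hHeeg ℓ hℓp hℓN
  by_cases hℓ2 : ℓ = 2
  · rw [hℓ2] at hv
    have : (2 : ℤ) ∣ NumberField.discr K := by exact_mod_cast hv
    omega
  · have hJ : J(NumberField.discr K | ℓ) = 1 := (Quadratic.ncard_primesOver_eq_two_iff_jacobiSym hfin hℓp hℓ2).mp hsp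
    haveI : NeZero ℓ := ⟨hℓp.ne_zero⟩
    have h0 : J(NumberField.discr K | ℓ) = 0 := by
      rw [jacobiSym.eq_zero_iff_not_coprime]
      intro hg
      have hdvd : ℓ ∣ Int.gcd (NumberField.discr K) ℓ := Int.dvd_gcd hv (dvd_refl _)
      rw [hg] at hdvd
      have := Nat.le_of_dvd one_pos hdvd
      have h2 := hℓp.two_le
      omega
    rw [h0] at hJ
    exact zero_ne_one hJ

/-! ### §2 The Kronecker character of `K` as a Dirichlet character mod `|d_K|` -/

/-- **The Kronecker character `κ = (·/|d_K|)`** for `d_K ≡ 1 (mod 8)` squarefree: a Dirichlet character mod `|d_K|` with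
`κ(ℓ) = (d_K/ℓ)` at every odd prime (quadratic reciprocity for the odd discriminant) and `κ(2) = 1 = (2/|d_K|)`; `|d_K|` is
odd. [cite: Cox2013, §1.C Lemma 1.14 and (1.18)] -/
theorem exists_kroneckerChar (K : Type) [Field K] [NumberField K] (h8 : NumberField.discr K % 8 = 1) :
    ∃ κ : DirichletCharacter ℂ (NumberField.discr K).natAbs,
      (∀ ℓ : ℕ, ℓ.Prime → ℓ ≠ 2 → κ ℓ = (jacobiSym (NumberField.discr K) ℓ : ℂ)) ∧
      (κ 2 = if NumberField.discr K % 8 = 1 then 1 else if NumberField.discr K % 8 = 5 then -1 else 0) ∧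
      Nat.Coprime 2 (NumberField.discr K).natAbs ∧
      (∀ n : ℕ, κ n = (J((n : ℤ) | (NumberField.discr K).natAbs) : ℂ)) := by
  set D := NumberField.discr K with hD
  have hD0 : D ≠ 0 := by omega
  haveI : NeZero D.natAbs := ⟨Int.natAbs_ne_zero.mpr hD0⟩
  have hD4 : D % 4 = 1 := by omega
  refine ⟨jacobiChar D.natAbs, fun ℓ hℓ hℓ2 => ?_, ?_, ?_, fun n => jacobiChar_natCast n⟩
  · rw [jacobiChar_natCast]
    have hodd : Odd ℓ := hℓ.odd_of_ne_two hℓ2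
    exact_mod_cast congrArg (fun z : ℤ => (z : ℂ)) (jacobiSym_natAbs_eq_of_emod_four_eq_one hD4 hodd)
  · rw [if_pos h8]
    have h := jacobiChar_natCast (q := D.natAbs) 2
    have h2 : J(((2 : ℕ) : ℤ) | D.natAbs) = 1 := by
      rw [Nat.cast_ofNat]; exact (jacobiSym_two_natAbs_eq_one_iff hD4).mpr h8
    rw [h2, Int.cast_one, Nat.cast_ofNat] at h
    exact h
  · have hodd : Odd D.natAbs := Int.natAbs_odd.mpr (Int.odd_iff.mpr (by omega))
    exact (Nat.Prime.coprime_iff_not_dvd Nat.prime_two).mpr (by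
      intro h2; exact (Nat.not_even_iff_odd.mpr hodd) (even_iff_two_dvd.mpr h2))

end Summit.BirchSwinnertonDyer.BirchSwinnertonDyer.Theorems.PrintCf2.DisegniPairTwo

end
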